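import Summits.CriticalPhenomena.SAWScalingLimit.Theses.SAWLeftRightFKG
import Summits.CriticalPhenomena.SAWScalingLimit.Theses.SAWTotalPositivity
import Summits.CriticalPhenomena.SAWScalingLimit.Theorems.FKGToTraversalBound.Negative.R1Split
import Summits.CriticalPhenomena.SAWScalingLimit.Theorems.FKGToTraversalBound.Negative.DeepStartNotPresentable

/-!
# Line `gates-by-bubble-doors-by-fkg` — skeleton for crux `FKGToTraversalBound` (stmt-CriticalPhenomena-1878)

Crux (route `SAWLeftRightFKG`, rank 3): `FKGToTraversalBound := LeftRightFKG → SAWTraversalBound` (`Iff.rfl`,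
Disproof §1 `iff_imp`; monotone in its hypothesis, `mono_hyp`, so there is no `_false_without_` to honour and every
proof is `PA → P`, `P → (H1)`).  Round 2.  Idea card `Ideas/gates-by-bubble-doors-by-fkg.md` (ideator 4), triage
TRIAGE-r2-1 / TRIAGE-r2-2 (pass ×2 with one MANDATORY repair, applied below; merge partner `pushdown-polygon-bubble`,
combine partner `slit-necklace`).

## The line in one paragraph

Every round-1 line died twice: (β) its ENGINE seed (a pocket / dive / door bound uniform in the rough past) silently
implies finiteness of a critical bubble (lead c1 F-B `EngineNeedsBubble.lean`; sharpened BN-4b/4c, BN5-7: sheathed or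
folded neck-and-room carriers push every uniform seed to the slit-plane / gadget grade, i.e. to
`SAWTotalPositivity.CriticalBubbleBound`, stmt-CriticalPhenomena-7117), and (α) its RESIDUE stub, (H1) on the
deep-endpoint fragment, has no instance of `LeftRightFKG` under any exploration (R1, `Negative/R1Split.lean`,
`deepStart_eventually_not_presentable`).  This line PRICES (β) exactly and keeps the engine interface of the
registered skeleton r8 (`Lines/excursion_domination.lean`): the uniform collared pocket bound `SAWCollarBound` is
re-derived from THREE named inputs instead of the dead `stub_sawDomination` —
* `CriticalBubbleBound` (STUB 1, the shared open item stmt-7117, hypothesis of the line, machine-readable);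
* the GATE LEMMA (STUB 2, the card's lever, provable now): given the bubble, everything strictly BEHIND a throat of
  lattice size `≤ w₀` is avoided with probability `≥ η(w₀) > 0`, uniformly in the carrier, the past and the room —
  PA-free excision (first/last throat visit, reconnection inside the throat box, fibre mass `≤ C(w₀)` by the
  splitting induction from the adjacent-pair bubble, closing loss `x_c^{-(w₀+1)²}`);
* the WIDE-DOOR SEED (STUB 3, where PA has teeth; OPEN scale-free RSW content = the round-1 canonical door numbers +
  sandwich): the collar bound for collars none of whose accesses is cut by a `w₀`-box;
assembled by the ACCESS TRICHOTOMY (STUB 4: narrow short = gate, narrow long = corridor (strip subcriticality ×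
bubble), wide = seed iterated along the aspect ratio; same-side far components multiplied up by PA).  Downstream the
line is r8 verbatim: `SAWCollarBound → GoodShellTight` (STUB 5 = r8 `stub_shellIterationCore`, the lattice
Kemppainen–Smirnov iteration at PRESENTABLE meshes, with the landed plumbing p99860/p100023/p102570/p115507/p116011),
and (α) is typed as the slit-necklace reduction (STUB 6, card `Ideas/slit-necklace.md` sharpened by triage r2-2 (2):
tail and beads of a deep-endpoint chord ARE 0-defect `LeftRightFKG` instances given their complement, so the uniform
engine applies piecewise) whose only outside input is the rate-free first-moment crossover-scale count
`GermExcursionMean` (STUB 7, BN5-6 ≡ triage `DeepNoReturn` kernel).  Glue (proved here, copied from r8): moduli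
combined by `max`, mesh-wise `shellTight_of_on`, quantile reduction `traversalBound_of_shellTight`; the composition
`FKGToTraversalBound_of` concludes the crux BY NAME.  `sorry` occurs only in the seven `stub_*` theorems.

## Triage repairs applied (TRIAGE-r2-1 W4 / TRIAGE-r2-2 witness)

`GatedPocketBound` as printed on the card ("M.card ≤ w₀, a, b ∉ R, ∂R ⊆ R ∪ M ⇒ η Z ≤ Z(avoid R ∖ collar)") is FALSE
for every `w₀ ≥ 2`: a THROUGH-room (1×10 strip; U-tube of depth `w₀+3`) is entered by the unique chord.  Repair = the
THROAT form below: the pocket is `Behind T` := the sites every `Ω_δ`-walk from `a` AND from `b` reaches only through the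
throat `T` (so through-rooms are never behind anything — no dead-end clause is needed, it is built in), `T` fits in
ONE lattice box of side `w₀` (the "diam M ≤ w₀ / mouth cluster" sharpening), and the RECONNECTION clause (any two
throat sites are joined inside the box through throat-or-behind sites — the "lining lemma" made a hypothesis, so the
U-tube with shafts merging deeper than `w₀` is excluded exactly when excision cannot reconnect).  With these three
clauses the lemma has a one-page proof (docstring of `GatedPocketBound`) and both triage witnesses fail a clause.

## Disproof / negatives honoured

F1 `mono_hyp`: the line ADDS hypotheses (`CriticalBubbleBound`, `GermExcursionMean`) as named stubs, never a costume of
the crux; no stub assumes `SAWTraversalBound` or restates `LeftRightFKG → SAWTraversalBound`.  §6/§9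
(`noFloatingHoles`, `not_presentable_of_enclosed`, `crux_iff_split`, `exists_isEndpointApprox_not_bdryApprox`,
`deepStart_eventually_not_presentable` p117623): STUB 5 claims presentable meshes only; STUB 6 must deliver at the
non-presentable meshes and says by which mechanism (static slit disintegration, 0-defect carriers only — F5 class);
the 1-defect classes `LeftRightFKGFree(Target)` (F6–F8, `leftRightFKG_false_without_boundaryAdjacency`) are never
instantiated.  F-B / BN-4c / BN5-7 (engine ⇒ bubble): imported as STUB 1 instead of evaded; the seed (STUB 3) is
restricted to WIDE collars, which exclude the neck (F-B), sheath (BN-4c) and fold (BN5-7) families by construction, and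
carries the bubble as hypothesis anyway.  SCOPE FINDING S-1 (this planner, sharpening F3(c)): lattice domains `D_δ` of
the tree's convention drop edges near every sharp (or suitably oriented) re-entrant corner of `∂D` for a cofinal set of
meshes, and such meshes are never presentable; they sit inside STUB 6's conclusion (`RoughMeshShellTight`, typed, with
the pre-certified split `deepShellTight_of_split`) and are flagged there — a statement-level wrinkle shared by r8
(`ResidualShellTight`) and every `Presentable`-based line, for the tenure planner.  Stub-level negatives of round 1 (`excursion-domination-stub1-false`: power-law
domination; `lid-collapse-needle-seeds-false`: lintel finger / forced dives; N1 mouth-Harnack) concern statements this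
line does not use (no RW comparison at all: the ε-scale is set by `G` and the seed, not by harmonic measure).
`ledger negatives`: stmt-0772 (all-δ Tight) only — immune (everything is per-approximation with its own `δ₀`).
-/

noncomputable section

open MeasureTheory Filter Topology Set Metric
open scoped NNReal ENNReal
open Literature.Probability.LatticeModels
open Literature.Probability.RandomPlanarGeometry
open Literature.Probability.RandomPlanarGeometry.SAW
open Summit.CriticalPhenomena.SAWScalingLimit.Theses.SAWLeftRightFKG
open Summit.CriticalPhenomena.SAWScalingLimit.Theses.SAWTotalPositivity (CriticalBubbleBound)
open Summit.CriticalPhenomena.SAWScalingLimit.Theorems.FKGToTraversalBound.Negative (dom lrLE)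

namespace Summit.CriticalPhenomena.SAWScalingLimit.Cruxes.FKGToTraversalBound.GatesByBubbleDoorsByFKG

/-! ## Vocabulary (verbatim from the registered skeleton r8 `Lines/excursion_domination.lean` where marked) -/

section Vocabulary

variable {Ω : Set ℂ} {δ : ℝ} {a b : Site 2}

/-- [r8 verbatim] The chords of `Ω_δ` from `a` to `b` that AVOID the set `H` of lattice sites. -/
def Avoid (H : Set (Site 2)) : Set (DomainSAW Ω δ a b) :=
  {γ | ∀ v ∈ γ.walk.support, v ∉ H}

end Vocabulary

/-- [r8 verbatim] A set `S` of chords is ONE-SIDED for the relation `le` (the route's left–right order `≼`):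
it is down-closed or up-closed. -/
def OneSided {ι : Type*} (le : ι → ι → Prop) (S : Set ι) : Prop :=
  (∀ γ₁ γ₂, le γ₁ γ₂ → γ₂ ∈ S → γ₁ ∈ S) ∨ (∀ γ₁ γ₂, le γ₁ γ₂ → γ₁ ∈ S → γ₂ ∈ S)

/-- [r8 verbatim] `u` and `v` are joined by a nearest-neighbour lattice path all of whose sites lie in `Λ` and
off `V`. -/
def JoinedOff (Λ V : Finset (Site 2)) (u v : Site 2) : Prop :=
  ∃ p : (zdGraph 2).Walk u v, ∀ x ∈ p.support, x ∈ Λ ∧ x ∉ V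

/-- The closed LATTICE BOX of side `w` (in lattice units) with lower-left corner `q`:
`{v : q₀ ≤ v₀ ≤ q₀ + w, q₁ ≤ v₁ ≤ q₁ + w}` — `(w+1)²` sites, `ℓ∞`-diameter `w`. -/
def InBox (q : Site 2) (w : ℕ) (v : Site 2) : Prop :=
  q 0 ≤ v 0 ∧ v 0 ≤ q 0 + w ∧ q 1 ≤ v 1 ∧ v 1 ≤ q 1 + w

/-- `x` lies **behind the throat `T`** in the lattice domain `Ω_δ`, seen from the two marked sites `a, b`: every
walk of `Ω_δ = discreteDomainGraph Ω δ` from `a` to `x` AND every walk from `b` to `x` passes through a site of `T`.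
(Sites of `T` are behind `T`; a site reachable from `a` or from `b` off `T` is not; in particular a THROUGH-room —
triage W4 — is behind nothing, and `a, b ∉ T` are never behind `T`.) -/
def Behind (Ω : Set ℂ) (δ : ℝ) (a b : Site 2) (T : Finset (Site 2)) (x : Site 2) : Prop :=
  (∀ p : (discreteDomainGraph Ω δ).Walk a x, ∃ y ∈ p.support, y ∈ T) ∧
  (∀ p : (discreteDomainGraph Ω δ).Walk b x, ∃ y ∈ p.support, y ∈ T)

/-! ## Statements of the line

All r2-side statements quantify over the binders of `LeftRightFKG` VERBATIM: mesh `δ > 0`, a closed lattice walk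
`C`, the carrier `dom C δ = {z | wind(δ-polyline of C, z) ≠ 0}` and endpoints `a, b` lattice-adjacent to vertices
`a', b'` of `C` (`leftRightFKG_iff_PAClause : … := Iff.rfl`). -/

/-- **GATED POCKET BOUND at throat size `w₀`** (the card's lever (G), THROAT FORM = the triage repair).  There is
`η = η(w₀) > 0` such that in every r2 carrier, for every THROAT `T` — a set of sites of `Ω_δ` inside one lattice box
`Q` of side `w₀`, missing `a` and `b`, and RECONNECTIBLE: any two throat sites are joined by an `Ω_δ`-walk inside `Q`
through throat-or-behind sites — the critical chord avoids everything behind `T` outside the box `Q` with probability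
`≥ η`:  `η · Z(a,b) ≤ Z{γ : every behind-site γ visits lies in Q}`.  Uniform in the carrier (hence in any presented
past), the mesh and the ROOM behind the throat, which is arbitrary.
PROOF CHART (given `CriticalBubbleBound`; STUB 2): for a chord `γ` that visits `T`, let `s`/`u` be its first/last visit
to `T`; `γ[0,s)` and `γ(u,1]` consist of sites joined to `a` resp. `b` off `T`, hence NOT behind; map
`γ ↦ γ* := γ[0,s] · p · γ[u,1]` with `p` a path inside `Q ∩ (T ∪ Behind)` from `γ(s)` to `γ(u)` (reconnection clause;
disjoint from prefix and suffix by the previous remark), so `γ*` is a chord in the target event with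
`|γ*| ≤ |γ[0,s]| + (w₀+1)² + |γ[u,1]|`; the fibre over `γ*` is `{ζ : SAW of Ω_δ from γ(s) to γ(u)}`, of mass
`≤ sup_Ω Z_Ω(t,t') ≤ C(w₀)` for `‖t - t'‖∞ ≤ w₀` — the SPLITTING INDUCTION from the adjacent-pair bubble
(`Z(0,v) ≤ Z(0,v')Z(v',v) + x_c⁻¹ Z(0,v')` for `v' ∼ v` one step closer: split at `v'` or append the edge `v v'`;
chords of `Ω_δ` are chords of a large box, `discreteDomainGraph ≤`); hence
`Z(visits T) ≤ x_c^{-(w₀+1)²} C(w₀) · Z(target)` and chords missing `T` are in the target already: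
`η := (1 + x_c^{-(w₀+1)²} C(w₀))⁻¹`.  WITNESS CHECK: the 1×10 strip and the U-tube of TRIAGE-r2-1/2 are through-rooms
(not behind) resp. fail reconnection inside the box (shafts merge at depth `w₀+3`); F-B's neck-and-room is the instance
`T` = the two top neck sites, `η Z ≤ Z(avoid lower neck ∪ room)`, i.e. (G) is F-B run backwards. -/
def GatedPocketBound (w₀ : ℕ) : Prop :=
  ∃ η : ℝ, 0 < η ∧ ∀ (δ : ℝ) (c a b a' b' : Site 2) (C : (zdGraph 2).Walk c c),
    0 < δ → a' ∈ C.support → b' ∈ C.support → (zdGraph 2).Adj a a' → (zdGraph 2).Adj b b' →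
    ∀ (T : Finset (Site 2)) (q : Site 2), a ∉ T → b ∉ T →
      (∀ t ∈ T, t ∈ meshDomain (dom C δ) δ ∧ InBox q w₀ t) →
      (∀ t ∈ T, ∀ t' ∈ T, ∃ p : (discreteDomainGraph (dom C δ) δ).Walk t t',
        ∀ x ∈ p.support, InBox q w₀ x ∧ (x ∈ T ∨ Behind (dom C δ) δ a b T x)) →
      ENNReal.ofReal η * weight (dom C δ) δ a b Set.univ ≤
        weight (dom C δ) δ a b
          {γ | ∀ v ∈ γ.walk.support, Behind (dom C δ) δ a b T v → InBox q w₀ v}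

/-- **Collar clauses with the collar set `V` explicit** (the body of r8's `IsCollaredOff`, verbatim): `V ⊆ Λ` lies in
the closed annulus `r ≤ |δx − z₀| ≤ R`; `a` is joined to `b` off `V` (the collar is AVOIDABLE); `H` misses the sites
joined to `a` off `V` and misses `V`; some non-domain site lies within `r + δ` of the centre (KS's clause
`∂B(z₀,r) ∩ ∂U_τ ≠ ∅`); and the orientation clauses (edges leaving `V` towards `Near` cross the inner circle, edges
leaving `V` towards sites joined to `H` cross the outer circle — or the other way round). -/
def CollarClauses (Λ : Finset (Site 2)) (a b : Site 2) (δ : ℝ) (z₀ : ℂ) (r R : ℝ)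
    (H V : Finset (Site 2)) : Prop :=
  V ⊆ Λ ∧
    (∀ x ∈ V, r ≤ dist (meshPoint δ x) z₀ ∧ dist (meshPoint δ x) z₀ ≤ R) ∧
    JoinedOff Λ V a b ∧
    (∀ y, JoinedOff Λ V a y → y ∉ H) ∧ (∀ x ∈ V, x ∉ H) ∧
    (∃ p : Site 2, p ∉ Λ ∧ dist (meshPoint δ p) z₀ ≤ r + δ) ∧
    ((∀ x ∈ V, ∀ y ∈ Λ, y ∉ V → (zdGraph 2).Adj x y →
        (JoinedOff Λ V a y → dist (meshPoint δ y) z₀ < r) ∧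
        ((∃ h ∈ H, JoinedOff Λ V y h) → R < dist (meshPoint δ y) z₀)) ∨
     (∀ x ∈ V, ∀ y ∈ Λ, y ∉ V → (zdGraph 2).Adj x y →
        (JoinedOff Λ V a y → R < dist (meshPoint δ y) z₀) ∧
        ((∃ h ∈ H, JoinedOff Λ V y h) → dist (meshPoint δ y) z₀ < r)))

/-- [r8, definitionally] **Collar structure**: some collar set `V` satisfies the collar clauses. -/
def IsCollaredOff (Λ : Finset (Site 2)) (a b : Site 2) (δ : ℝ) (z₀ : ℂ) (r R : ℝ)
    (H : Finset (Site 2)) : Prop :=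
  ∃ V : Finset (Site 2), CollarClauses Λ a b δ z₀ r R H V

/-- **WIDE collar structure at lattice width `w₀`** (the card's regime (D), "doors"): a collar structure whose accesses
are nowhere cut by a lattice box of side `w₀` — for every box `Q` of side `w₀` that TOUCHES the collar set `V` and misses
`a, b`, every site of `H` is still joined to `a` inside `Λ` off `Q`.  Excludes by construction every access of lattice
width `≤ w₀`: the neck-and-room carriers of F-B (width 2), the sheathed necks of BN-4c and the folded rooms of BN5-7 —
the three families through which a uniform pocket bound forces a bubble — and every narrow corridor. -/
def WideCollaredOff (Λ : Finset (Site 2)) (a b : Site 2) (δ : ℝ) (z₀ : ℂ) (r R : ℝ)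
    (H : Finset (Site 2)) (w₀ : ℕ) : Prop :=
  ∃ V : Finset (Site 2), CollarClauses Λ a b δ z₀ r R H V ∧
    ∀ q : Site 2, ¬ InBox q w₀ a → ¬ InBox q w₀ b → (∃ v ∈ V, InBox q w₀ v) →
      ∀ h ∈ H, ∃ p : (zdGraph 2).Walk a h, ∀ x ∈ p.support, x ∈ Λ ∧ ¬ InBox q w₀ x

/-- [r8 verbatim — the ENGINE INTERFACE, registered on the item as the consumer side of `stub_shellIterationCore`]
**SAW collar bound** (the uniform pocket lemma): there are `M > 1`, `η > 0` such that in every r2 domain the critical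
chord avoids every ONE-SIDED set `H` collared off by an annulus of modulus `M` (`δ ≤ r`, `M r ≤ R`) with probability
`≥ η`: `η · Z_Ω(a,b) ≤ Z_{Ω, avoid H}(a,b)`.  Uniform in the domain, the past (any presented slit domain is an r2
domain) and the mesh.  By F-B/BN-4c/BN5-7 it implies a bubble bound of `CriticalBubbleBound` grade — which this line
supplies as STUB 1 instead of hiding. -/
def SAWCollarBound : Prop :=
  ∃ (M η : ℝ), 1 < M ∧ 0 < η ∧ ∀ (δ : ℝ) (c a b a' b' : Site 2) (C : (zdGraph 2).Walk c c),
    0 < δ → a' ∈ C.support → b' ∈ C.support → (zdGraph 2).Adj a a' → (zdGraph 2).Adj b b' →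
    ∀ (hΛ : (meshDomain (dom C δ) δ).Finite) (z₀ : ℂ) (r R : ℝ) (H : Finset (Site 2)),
      δ ≤ r → M * r ≤ R → IsCollaredOff hΛ.toFinset a b δ z₀ r R H →
      OneSided (lrLE (Ω := dom C δ) (δ := δ) (a := a) (b := b))
        (Avoid (H : Set (Site 2)) : Set (DomainSAW (dom C δ) δ a b)) →
      ENNReal.ofReal η * weight (dom C δ) δ a b Set.univ ≤
        weight (dom C δ) δ a b (Avoid (H : Set (Site 2)))

/-- **WIDE-DOOR COLLAR BOUND at lattice width `w₀`** (the SEED; the card's `WideDoorG1` in collar form): the SAW collar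
bound asserted only for WIDE collar structures (`WideCollaredOff … w₀`).  This is the scale-free RSW regime where PA is
meant to work (round-1 seeds: canonical door numbers DoorSquare 1.540/1.531 at n = 2, 3, two-stump door, carve / fill /
sandwich reductions `stub_carveCore` p85301); no bubble obstruction of the F-B type can be built inside the class. -/
def WideCollarBound (w₀ : ℕ) : Prop :=
  ∃ (M η : ℝ), 1 < M ∧ 0 < η ∧ ∀ (δ : ℝ) (c a b a' b' : Site 2) (C : (zdGraph 2).Walk c c),
    0 < δ → a' ∈ C.support → b' ∈ C.support → (zdGraph 2).Adj a a' → (zdGraph 2).Adj b b' →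
    ∀ (hΛ : (meshDomain (dom C δ) δ).Finite) (z₀ : ℂ) (r R : ℝ) (H : Finset (Site 2)),
      δ ≤ r → M * r ≤ R → WideCollaredOff hΛ.toFinset a b δ z₀ r R H w₀ →
      OneSided (lrLE (Ω := dom C δ) (δ := δ) (a := a) (b := b))
        (Avoid (H : Set (Site 2)) : Set (DomainSAW (dom C δ) δ a b)) →
      ENNReal.ofReal η * weight (dom C δ) δ a b Set.univ ≤
        weight (dom C δ) δ a b (Avoid (H : Set (Site 2)))

/-- [r8 verbatim] **Per-shell tightness of the traversal counts** for the shells of modulus `≥ M`. -/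
def ShellTight (M : ℝ) (D : DobrushinDomain) (a b : ℝ → Site 2) : Prop :=
  ∃ δ₀ : ℝ, 0 < δ₀ ∧ ∀ (x : ℂ) (ρ R : ℝ), 0 < ρ → M * ρ ≤ R → R ≤ 1 → ∀ ε : ℝ, 0 < ε → ∃ n : ℕ,
    ∀ δ ∈ Set.Ioc (0 : ℝ) δ₀, δ ≤ ρ →
      law D.carrier δ (a δ) (b δ)
          {γ | (⟨γ.walk.toCurve (meshPoint δ)⟩ : Curve ℂ).HasTraversals n x ρ R} ≤
        ENNReal.ofReal ε

/-- [r8 verbatim] **Per-shell tightness on a class of MESHES** (`P δ`). -/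
def ShellTightOn (P : ℝ → Prop) (M : ℝ) (D : DobrushinDomain) (a b : ℝ → Site 2) : Prop :=
  ∃ δ₀ : ℝ, 0 < δ₀ ∧ ∀ (x : ℂ) (ρ R : ℝ), 0 < ρ → M * ρ ≤ R → R ≤ 1 → ∀ ε : ℝ, 0 < ε → ∃ n : ℕ,
    ∀ δ ∈ Set.Ioc (0 : ℝ) δ₀, δ ≤ ρ → P δ →
      law D.carrier δ (a δ) (b δ)
          {γ | (⟨γ.walk.toCurve (meshPoint δ)⟩ : Curve ℂ).HasTraversals n x ρ R} ≤
        ENNReal.ofReal ε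

/-- [r8 verbatim; its body is the `Presentable` of `Negative.deepStart_not_presentable`] The lattice domain `D_δ` with
endpoints `u, v` is **presentable** as an instance of `LeftRightFKG`. -/
def Presentable (D : DobrushinDomain) (δ : ℝ) (u v : Site 2) : Prop :=
  ∃ (c u' v' : Site 2) (C : (zdGraph 2).Walk c c), u' ∈ C.support ∧ v' ∈ C.support ∧
    (zdGraph 2).Adj u u' ∧ (zdGraph 2).Adj v v' ∧
    discreteDomainGraph D.carrier δ = discreteDomainGraph (dom C δ) δ

/-- [r8 verbatim] Output of the iteration: per-shell tightness at some modulus `M > 1`, for every endpoint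
approximation, AT THE PRESENTABLE MESHES.  SCOPE FINDING of this planner (S-1, sharpening Disproof F3(c)): r2 graphs
are INDUCED, so a mesh at which `D_δ = discreteDomainGraph D.carrier δ` drops a lattice edge between two of its sites
(`¬ InducedMesh`) is never presentable — and this happens for a COFINAL set of meshes (generic position of the tip
relative to `δℤ²`) as soon as `∂D` has a re-entrant exterior wedge crossed transversally by a lattice direction:
always when its opening is `< π/2` (interior angle `> 3π/2`: any slit-like bay), orientation-dependent for openings in
`[π/2, π)`, never for the axis-parallel L-corner — so not only for oscillating prime ends; for such `D` this statement is
silent at those meshes and `DeepShellTight` carries them. -/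
def GoodShellTight : Prop :=
  ∃ M : ℝ, 1 < M ∧ ∀ (D : DobrushinDomain) (a b : ℝ → Site 2),
    IsEndpointApprox D a b → ShellTightOn (fun δ => Presentable D δ (a δ) (b δ)) M D a b

/-- The lattice domain `D_δ` is an INDUCED subgraph of `ℤ²` on its vertex set: no lattice edge between two sites of
`meshDomain` is dropped (the Chelkak–Hongler–Izyurov convention `[δx, δy] ⊆ Ω̄` drops an edge when a thin exterior fjord
passes between two interior mesh points — near the tip of any sharp re-entrant exterior wedge, at every scale). -/
def InducedMesh (D : DobrushinDomain) (δ : ℝ) : Prop :=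
  ∀ x ∈ meshDomain D.carrier δ, ∀ y ∈ meshDomain D.carrier δ,
    (zdGraph 2).Adj x y → (discreteDomainGraph D.carrier δ).Adj x y

/-- **Deep-fragment per-shell tightness** (the (α) conjunct of `crux_iff_split` in the line's currency): per-shell
tightness at SOME modulus `M > 1`, for every endpoint approximation, AT THE NON-PRESENTABLE MESHES — (i) deep
endpoints on induced meshes (`deepStart_eventually_not_presentable`: non-presentable at every small mesh, so no `δ₀`
makes this vacuous) — the slit necklace's territory, `DeepShellTightInduced`; and (ii) NON-INDUCED meshes (S-1 above,
`RoughMeshShellTight`), where no piece of the chord lives on an r2 graph and the intended treatment is comparison with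
the INDUCED COMPANION law by local finite energy at the blocked edges (boundedly many per corner for tame `D`; OPEN for
wild Jordan boundaries).  r8's `ResidualShellTight` asked all of it for EVERY `M > 1`; the glue only needs one modulus
(`shellTightOn_mono`, `max`), and `deepShellTight_of_split` certifies the split (i) + (ii) ⇒ this for a later glued
split of STUB 6. -/
def DeepShellTight : Prop :=
  ∃ M : ℝ, 1 < M ∧ ∀ (D : DobrushinDomain) (a b : ℝ → Site 2),
    IsEndpointApprox D a b → ShellTightOn (fun δ => ¬ Presentable D δ (a δ) (b δ)) M D a b

/-- (i) of `DeepShellTight`: the non-presentable INDUCED meshes (deep endpoints proper). -/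
def DeepShellTightInduced : Prop :=
  ∃ M : ℝ, 1 < M ∧ ∀ (D : DobrushinDomain) (a b : ℝ → Site 2),
    IsEndpointApprox D a b →
      ShellTightOn (fun δ => ¬ Presentable D δ (a δ) (b δ) ∧ InducedMesh D δ) M D a b

/-- (ii) of `DeepShellTight`: the NON-INDUCED meshes (rough discretisations; Disproof F3(c) sharpened to S-1). -/
def RoughMeshShellTight : Prop :=
  ∃ M : ℝ, 1 < M ∧ ∀ (D : DobrushinDomain) (a b : ℝ → Site 2),
    IsEndpointApprox D a b → ShellTightOn (fun δ => ¬ InducedMesh D δ) M D a b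

/-- **GERM EXCURSION MEAN** (the rate-free residue of the deep conjunct; triage r2-2 sharpen (2) ≡ BN5-6 `DeepNoReturn`
kernel in first-moment form).  For every endpoint approximation there are `M̄`, `C₀ > 11/10`, `δ₀ > 0` such that for
`δ ≤ δ₀` the EXPECTED NUMBER of separate traversals by the chord of the crossover annulus
`D(a_δ; 1.1 d, C₀ d)`, `d = d(δ) := dist(δ·a_δ, ∂D)` (inner radius just outside the depth ball, SHRINKING with `δ`), is
at most `M̄` — and the same at `b`.  (`E[N] = Σ_{k ≥ 1} P(N ≥ k)`, `HasTraversals` is monotone in `k`.)  For boundary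
approximations `d ≍ δ` and the count is deterministically bounded (`k ≤ 2|γ ∩ annulus|`), so the statement has content
exactly on the deep fragment; conjecturally true with geometric tails (interior returns of SLE_{8/3} to a fixed-ratio
annulus about its starting region); numerically testable (ideator-4 `necklace.py` regime); shared with every tightness
route; its natural quenched proof would condition on a floating past (F7 / triage X1, j011295) — which is why it is
filed as an INPUT and not hidden in STUB 6. -/
def GermExcursionMean : Prop :=
  ∀ (D : DobrushinDomain) (a b : ℝ → Site 2), IsEndpointApprox D a b →
    ∃ (Mbar C₀ δ₀ : ℝ), 11 / 10 < C₀ ∧ 0 < δ₀ ∧ ∀ δ ∈ Set.Ioc (0 : ℝ) δ₀,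
      (∑' k : ℕ, law D.carrier δ (a δ) (b δ)
          {γ | (⟨γ.walk.toCurve (meshPoint δ)⟩ : Curve ℂ).HasTraversals (k + 1) (meshPoint δ (a δ))
            (11 / 10 * infDist (meshPoint δ (a δ)) D.carrierᶜ) (C₀ * infDist (meshPoint δ (a δ)) D.carrierᶜ)})
        ≤ ENNReal.ofReal Mbar ∧
      (∑' k : ℕ, law D.carrier δ (a δ) (b δ)
          {γ | (⟨γ.walk.toCurve (meshPoint δ)⟩ : Curve ℂ).HasTraversals (k + 1) (meshPoint δ (b δ))
            (11 / 10 * infDist (meshPoint δ (b δ)) D.carrierᶜ) (C₀ * infDist (meshPoint δ (b δ)) D.carrierᶜ)})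
        ≤ ENNReal.ofReal Mbar

/-! ## Stubs (registered; `sorry` only here) -/

/-- STUB 1 — **the critical bubble bound** `G_{x_c}(0,e₁) < ∞` on `ℤ²`, VERBATIM the shared item
stmt-CriticalPhenomena-7117 (`SAWTotalPositivity.CriticalBubbleBound`, rank 4 of the sibling route, open-problem grade:
Madras–Slade 1993 p. 22 / p. 259; Hammond 2018 Thm 1.3 density-one only; two certified reduction lines on the sibling
crux — `criticalBubbleBound_of_dockingEntropy_of_pinchRarity`, `criticalBubbleBound_of_disjointnessGain_of_pinnedLengthMassBound`).
The HYPOTHESIS of this line: every uniform engine of this crux implies a bubble of this grade (F-B `EngineNeedsBubble`,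
BN-4c sheath ⇒ `slitPlaneBubble`, BN5-7 fold ⇒ gadget bubble), so the honest typing names it; closing this stub IS
closing stmt-7117 (`blocked-on: stmt-CriticalPhenomena-7117`, machine-readable, as triage N-r2-1 asked). -/
theorem stub_criticalBubble : CriticalBubbleBound := by
  sorry

/-- STUB 2 (the card's lever; PROVABLE NOW, size L in Lean) — **bubble ⇒ gated pocket bound at every throat size**.
Proof chart in the docstring of `GatedPocketBound`: first/last throat-visit decomposition, reconnection inside the box
(hypothesis), fibre mass bounded by the two-point function between box sites, which the SPLITTING INDUCTION bounds by
`C(w₀) < ∞` from the adjacent-pair `CriticalBubbleBound` (chords of the bounded carrier `dom C δ` —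
`Theorems.…ExcursionDomination.stub_domBounded` p87093 — inject into chords of a large box: `discreteDomainGraph` is
monotone for box-shaped `Ω`), closing loss `x_c^{-(w₀+1)²}`; bookkeeping with `weight_eq_tsum_preimage` (DomainMarkov
p85820) over the excision map.  No PA, no RW.  Honest joint: building `γ*` as a `DomainSAW` (path surgery:
`takeUntil`/`dropUntil`, `isPath_append_iff` p85820). -/
theorem stub_gateExcision : CriticalBubbleBound → ∀ w₀ : ℕ, GatedPocketBound w₀ := by
  sorry

/-- STUB 3 (HARDEST; OPEN — where PA has teeth) — **bubble + left–right PA ⇒ the wide-door collar bound at some lattice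
width `w₀`**.  The scale-free RSW content of the route: on WIDE collar structures (no access of lattice width `≤ w₀`)
the critical chord avoids the one-sided far side with probability `≥ η`, uniformly.  Intended route = round 1's
reductions, now legitimate because their rough residue (stumps forming necks, narrow mouths) is paid by STUBS 1–2 and
excluded from the class: CARVE/FILL/SANDWICH monotonicities from `LeftRightFKG` (`stub_carveCore` p85301, triage X3)
reduce a wide rough door to CANONICAL doors (D₄-symmetric rectangles / annular sectors at scale `≥ w₀δ`), whose numbers
are scale-free ratios of x_c-partition functions (DoorSquare 1.540 / 1.531 at n = 2, 3; two-stump door; Kesten's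
bridge-mass identity `Σ_k λ_k μ^{-k} = 1`, `a_N ≤ 1`, MadrasSlade1993 (4.2.4), for the scale-invariant ε; corner transfer
matrices `W ≤ 12` for certified numerics).  `CriticalBubbleBound` is a hypothesis because a mouth of moderate width
`W > w₀` still carries `sup_Ω Z_Ω(u,u')`, `‖u−u'‖ ≤ W`, finite only by the splitting induction from the bubble.
CLASS NOTE: `WideCollaredOff` is the ROBUST (cut-box) notion — rough, dented walls do not spoil it — and therefore still
admits REDUNDANT narrow through-channels forming loops with the wide access (no single box cuts them); the prover treats
those by corridor decay (bubble available) or receives only cleaned structures from STUB 4 — a division of labour left to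
the lead (both stubs carry `CriticalBubbleBound`).
WHY IT MIGHT FAIL: no RSW for the critical SAW in print (KS17 §4 verifies G2 only where FKG is available; Disproof F4:
consistent, unattackable by finite computation); BN-C (PA is dimensionless: it transports an ε, it does not create one)
— the ε must come from the canonical door numbers, i.e. from an x_c-computation, and the reduction wide-rough → canonical
is itself unproved. -/
theorem stub_wideDoorSeed : CriticalBubbleBound → LeftRightFKG → ∃ w₀ : ℕ, WideCollarBound w₀ := by
  sorry

/-- STUB 4 (size L/XL; the geometric assembly) — **ACCESS TRICHOTOMY: gates + wide doors (+ bubble, + PA) ⇒ the SAW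
collar bound.**  Given a collar structure `(V, H)` of modulus `M` at inner radius `r = kδ`, decompose the accesses from
`Near` to the far side through the annulus into CHANNELS (components of `V`); (i) a channel of lattice width `≤ w₀` is
cut by a `w₀`-box at its near end — a THROAT with everything beyond it behind (reconnection inside the box along the
channel) — so the gate lemma gives avoidance `≥ η(w₀)`, and, being `≥ (M−1)k` long, it is a CORRIDOR: strip
subcriticality `μ_w < μ` (Hammersley–Whittington 1985; transfer-matrix certified for `w ≤ 13` in
`NegativeNote-stubSawDomination-comb.md`) with the bubble for the far mass improves this to `1 − C θ^{(M−1)k}`;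
(ii) the WIDE channels form a wide collar structure — the seed, iterated along the aspect ratio through presented slit
domains (`SlitPresentation` p102570, `Sweep` p100023, domain Markov p85820) gives `1 − e^{-c·aspect}`;
(iii) `Σ_j p_j ≤ C₀(M)` uniformly in `k` (convexity: `K` channels of widths `W_j`, `Σ W_j ≤ 2πMk`), and the far
components behind distinct channels are SAME-SIDE pockets, so `LeftRightFKG` (positive association of same-side
avoidances, the complement form of `stub_carveCore`) multiplies: `P(avoid all) ≥ Π_j (1 − p_j) ≥ η(M, w₀) > 0`.
WHY IT MIGHT FAIL (named, BN-4d): the channel decomposition on the lattice (channels branch, merge beyond `R`, kiss at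
points), the re-entry comparison for THROUGH-channels (enter by one channel, leave by another: no excision, needs the
monotone re-entry bound `Z_after-excursion ≤ Z_escape` or a direct corridor count), and one-sidedness of the individual
far components (needed for the PA product; lattice crosscut lemma). -/
theorem stub_collarAssembly :
    CriticalBubbleBound → (∀ w₀ : ℕ, GatedPocketBound w₀) → (∃ w₀ : ℕ, WideCollarBound w₀) →
      LeftRightFKG → SAWCollarBound := by
  sorry

/-- STUB 5 (XL, CHARTED; = r8 `stub_shellIterationCore` with its two plumbing hypotheses already LANDED) — **the
Kemppainen–Smirnov iteration on the lattice at the presentable meshes**: `SAWCollarBound → GoodShellTight`.  Landed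
inputs to import, not re-plan: `TreeTailBound` p99860 (adapted KS counting, Prop. 3.5), `Sweep` p100023 and
`SlitPresentation` p102570 (the r2 class is closed under conditioning on a prefix from a boundary-adjacent start),
domain Markov p85820, traversal dictionary p115507 (`ShellIterationGeometry`: polyline `HasTraversals` ⇄ lattice
crossings) and p116011 (`ShellIterationSubwalks`); the certified obstruction to the naive KS index (426-step serpentine:
index jumps +5 at one unforced entrance) means the counting hypothesis of `TreeTailBound` is fed with `up := unforced
crossing of one of three sub-annuli` (AMORTISED count) and the next def-free piece is the δ-uniform forced count H4
(lead c2 NOTES).  Not this line's mechanism; shared verbatim with r8. -/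
theorem stub_shellIteration : SAWCollarBound → GoodShellTight := by
  sorry

/-- STUB 6 (XL; IMPORTED MECHANISM — card `Ideas/slit-necklace.md`, ideator 4, sharpened by TRIAGE-r2-2 (1)–(5) and
TRIAGE-r2-1 N-r2-3) — **the slit-necklace reduction of the deep fragment**: `SAWCollarBound → GermExcursionMean →
DeepShellTight`.  For a deep endpoint `a_δ` hang the chord on an attached slit `π` (shortest lattice path from a
boundary-adjacent site to `a_δ`, `diam π ≤ 2·depth`); `L` := LAST visit to `π`, necklace `ω := γ[0,L]`, tail
`γ⁺ := γ(L,1]`, beads := maximal runs of `ω` off `π`.  (T) given `ω`, the tail IS the critical chord of the PRESENTED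
slit carrier (swept, `SlitPresentation`/`Sweep`) from `γ(L+1) ∼ γ(L)` to `b_δ` — a 0-defect `LeftRightFKG` instance, so
the uniform engine and STUB 5's iteration apply to it; (B) given its complement each bead is again a 0-defect instance
between two `π`-adjacent sites; enclosure (hole-freeness: the tail lies outside every bead loop) and nesting (beads force
each other only by inner nesting, which telescopes; one input scale suffices by the factorial-moment peeling of triage
r2-2) close the accounting EXCEPT for the number of far beads / middle pieces, which is `≤ ½ ·` (traversal count of the
crossover annulus `D(a_δ; 1.1d, C₀d)`) — `GermExcursionMean`, Markov's inequality, shell-dependent threshold; both-deep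
approximations use the statement at `a` and at `b`; sub-depth shells are moot per fixed shell eventually
(`EventualShellReduction`, ideator 5 / BN5-1, provable now: `k ≤ 2|γ|`).  Bead departure SIDES belong in the skeleton
of the proof (nesting is not determined by visit sites alone).  WHY IT MIGHT FAIL: BN-4a (freeze/float dichotomy) is
localised, not evaded — bead→tail forcing is charged to the beads' own traversals "as in KS", plausible, unproved; and the
engine is consumed QUENCHED (only a uniform-over-r2 engine plugs into (T)/(B), triage Q2), which is exactly why STUB 1
is on this line.  SCOPE (S-1): the necklace mechanism delivers `DeepShellTightInduced`; the conclusion also contains the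
NON-INDUCED meshes `RoughMeshShellTight` (sharp or suitably oriented re-entrant corners of `∂D`, cofinally in `δ`; wild
prime ends), for which the intended proof is the comparison with the induced companion law by local finite energy at
the O(1) blocked edges per corner (tame `D`), and which is OPEN for wild Jordan boundaries — a glued split of this stub
along `deepShellTight_of_split` is pre-certified below; the tenure-level fix is an `InducedMesh` restriction of the
conjunct's lattice convention, in the manner of R1. -/
theorem stub_necklace : SAWCollarBound → GermExcursionMean → DeepShellTight := by
  sorry

/-- STUB 7 (OPEN, rate-free; the residue of the deep conjunct, filed as an explicit input — BN5-6 / triage r2-2 (2);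
two round-2 ideators converge on it) — **germ excursion mean** at both marked points.  Cheapest falsifier: exact
enumeration on both-deep 6×6 / 7×6 carriers (the disprover's `lrc.c` census machinery): a traversal count of
`D(a_δ; 2δ', 4δ')`-type crossover annuli whose MEAN grows with the box at `x_c` kills it. -/
theorem stub_germExcursionMean : GermExcursionMean := by
  sorry

/-! ## Glue (sorry-free; `shellTight_of_on`, `law_le_one`, `eps_pos`, `rpow_three`, `traversalBound_of_shellTight`
copied from r8, where they are proved in the same words) -/

/-- Per-shell tightness on a mesh class is MONOTONE in the modulus: a larger `M` asks for fewer shells. -/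
theorem shellTightOn_mono {P : ℝ → Prop} {M M' : ℝ} {D : DobrushinDomain} {a b : ℝ → Site 2}
    (hMM' : M ≤ M') (h : ShellTightOn P M D a b) : ShellTightOn P M' D a b := by
  obtain ⟨δ₀, hδ₀, H⟩ := h
  refine ⟨δ₀, hδ₀, fun x ρ R hρ hMR hR1 ε hε => ?_⟩
  exact H x ρ R hρ (le_trans (mul_le_mul_of_nonneg_right hMM' hρ.le) hMR) hR1 ε hε

/-- [r8] **Mesh-wise glue**: per-shell tightness on a class of meshes and on its complement give per-shell
tightness (`δ₀ := min`, `n := max`, `HasTraversals.of_le`). -/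
theorem shellTight_of_on {P : ℝ → Prop} {M : ℝ} {D : DobrushinDomain} {a b : ℝ → Site 2}
    (h₁ : ShellTightOn P M D a b) (h₂ : ShellTightOn (fun δ => ¬ P δ) M D a b) : ShellTight M D a b := by
  classical
  obtain ⟨δ₁, hδ₁, H₁⟩ := h₁
  obtain ⟨δ₂, hδ₂, H₂⟩ := h₂
  refine ⟨min δ₁ δ₂, lt_min hδ₁ hδ₂, ?_⟩
  intro x ρ R hρ hMR hR1 ε hε
  obtain ⟨n₁, hn₁⟩ := H₁ x ρ R hρ hMR hR1 ε hε
  obtain ⟨n₂, hn₂⟩ := H₂ x ρ R hρ hMR hR1 ε hε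
  refine ⟨max n₁ n₂, ?_⟩
  intro δ hδ hδρ
  have hδ1 : δ ∈ Set.Ioc (0 : ℝ) δ₁ := ⟨hδ.1, hδ.2.trans (min_le_left _ _)⟩
  have hδ2 : δ ∈ Set.Ioc (0 : ℝ) δ₂ := ⟨hδ.1, hδ.2.trans (min_le_right _ _)⟩
  by_cases hP : P δ
  · refine le_trans (measure_mono ?_) (hn₁ δ hδ1 hδρ hP)
    intro γ hγ
    exact Curve.HasTraversals.of_le hγ (le_max_left _ _)
  · refine le_trans (measure_mono ?_) (hn₂ δ hδ2 hδρ hP)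
    intro γ hγ
    exact Curve.HasTraversals.of_le hγ (le_max_right _ _)

/-- **Cover glue**: per-shell tightness on two mesh classes gives it on any class they cover
(`δ₀ := min`, `n := max`, `HasTraversals.of_le`). -/
theorem shellTightOn_of_cover {P P₁ P₂ : ℝ → Prop} {M : ℝ} {D : DobrushinDomain} {a b : ℝ → Site 2}
    (h₁ : ShellTightOn P₁ M D a b) (h₂ : ShellTightOn P₂ M D a b) (hcov : ∀ δ, P δ → P₁ δ ∨ P₂ δ) :
    ShellTightOn P M D a b := by
  classical
  obtain ⟨δ₁, hδ₁, H₁⟩ := h₁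
  obtain ⟨δ₂, hδ₂, H₂⟩ := h₂
  refine ⟨min δ₁ δ₂, lt_min hδ₁ hδ₂, ?_⟩
  intro x ρ R hρ hMR hR1 ε hε
  obtain ⟨n₁, hn₁⟩ := H₁ x ρ R hρ hMR hR1 ε hε
  obtain ⟨n₂, hn₂⟩ := H₂ x ρ R hρ hMR hR1 ε hε
  refine ⟨max n₁ n₂, ?_⟩
  intro δ hδ hδρ hP
  have hδ1 : δ ∈ Set.Ioc (0 : ℝ) δ₁ := ⟨hδ.1, hδ.2.trans (min_le_left _ _)⟩
  have hδ2 : δ ∈ Set.Ioc (0 : ℝ) δ₂ := ⟨hδ.1, hδ.2.trans (min_le_right _ _)⟩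
  rcases hcov δ hP with hP₁ | hP₂
  · refine le_trans (measure_mono ?_) (hn₁ δ hδ1 hδρ hP₁)
    intro γ hγ
    exact Curve.HasTraversals.of_le hγ (le_max_left _ _)
  · refine le_trans (measure_mono ?_) (hn₂ δ hδ2 hδρ hP₂)
    intro γ hγ
    exact Curve.HasTraversals.of_le hγ (le_max_right _ _)

/-- **Pre-certified glued split of STUB 6** (scope finding S-1): the necklace part (non-presentable INDUCED meshes) and
the rough-mesh part (NON-INDUCED meshes) together give `DeepShellTight` (moduli by `max`, classes by cover). -/
theorem deepShellTight_of_split (h₁ : DeepShellTightInduced) (h₂ : RoughMeshShellTight) : DeepShellTight := by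
  obtain ⟨M₁, hM₁, H₁⟩ := h₁
  obtain ⟨M₂, -, H₂⟩ := h₂
  refine ⟨max M₁ M₂, lt_max_of_lt_left hM₁, fun D a b hab => ?_⟩
  refine shellTightOn_of_cover (shellTightOn_mono (le_max_left _ _) (H₁ D a b hab))
    (shellTightOn_mono (le_max_right _ _) (H₂ D a b hab)) fun δ hP => ?_
  by_cases hI : InducedMesh D δ
  · exact Or.inl ⟨hP, hI⟩
  · exact Or.inr hI

/-- [r8] Whatever the junk conventions, the SAW law gives mass at most `1` to every event. -/
theorem law_le_one (Ω : Set ℂ) (δ : ℝ) (u v : Site 2) (S : Set (DomainSAW Ω δ u v)) :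
    law Ω δ u v S ≤ 1 := by
  calc law Ω δ u v S ≤ law Ω δ u v Set.univ := measure_mono (Set.subset_univ _)
    _ = (weight Ω δ u v Set.univ)⁻¹ * weight Ω δ u v Set.univ := by
        rw [law, Measure.smul_apply, smul_eq_mul]
    _ ≤ 1 := ENNReal.inv_mul_le_one _

/-- [r8] The target probability `M³ (ρ/R)³` of a shell of modulus `≥ M` is positive. -/
theorem eps_pos {M ρ R : ℝ} (hM : 1 < M) (hρ : 0 < ρ) (h : M * ρ ≤ R) :
    0 < M ^ 3 * (ρ / R) ^ 3 := by
  have hM0 : 0 < M := by linarith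
  have hR : 0 < R := lt_of_lt_of_le (by positivity) h
  positivity

/-- [r8] Real power with exponent `3` is the monomial. -/
theorem rpow_three (t : ℝ) : t ^ (3 : ℝ) = t ^ (3 : ℕ) := by
  rw [← Real.rpow_natCast]; norm_num

/-- [r8, triage X2] **Per-shell tightness ⇒ (H1)**: with `K = M³`, `λ = 3` and the threshold `k(x, ρ, R) :=` the
`M³(ρ/R)³`-quantile of the traversal count when `M ρ ≤ R ≤ 1` (and `0` otherwise, where `K (ρ/R)³ > 1 ≥ law` is
free), per-shell tightness at modulus `M` gives `SAWTraversalBound`. -/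
theorem traversalBound_of_shellTight {M : ℝ} (hM : 1 < M)
    (h : ∀ (D : DobrushinDomain) (a b : ℝ → Site 2), IsEndpointApprox D a b → ShellTight M D a b) :
    SAWTraversalBound := by
  classical
  intro D a b hab
  obtain ⟨δ₀, hδ₀, H⟩ := h D a b hab
  have hM0 : 0 < M := by linarith
  choose n hn using H
  set k : ℂ → ℝ → ℝ → ℕ := fun x ρ R =>
    if hc : 0 < ρ ∧ M * ρ ≤ R ∧ R ≤ 1 then
      n x ρ R hc.1 hc.2.1 hc.2.2 (M ^ 3 * (ρ / R) ^ 3) (eps_pos hM hc.1 hc.2.1)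
    else 0 with hk
  refine ⟨k, M ^ 3, 3, δ₀, by positivity, by norm_num, hδ₀, ?_⟩
  intro δ hδ x ρ R hδρ hρR hR1
  have hρ : 0 < ρ := hδ.1.trans_le hδρ
  have hR : 0 < R := hρ.trans hρR
  rw [rpow_three]
  by_cases hcase : M * ρ ≤ R
  · have hkx : k x ρ R =
        n x ρ R hρ hcase hR1 (M ^ 3 * (ρ / R) ^ 3) (eps_pos hM hρ hcase) := by
      simp only [hk, dif_pos (And.intro hρ (And.intro hcase hR1))]
    rw [hkx]
    exact hn x ρ R hρ hcase hR1 _ _ δ hδ hδρ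
  · have hcase : R < M * ρ := lt_of_not_ge hcase
    have hbig : (1 : ℝ) ≤ M ^ 3 * (ρ / R) ^ 3 := by
      have h1 : 1 < M * (ρ / R) := by
        rw [mul_div_assoc', lt_div_iff₀ hR]
        linarith
      have h2 : (1 : ℝ) ≤ (M * (ρ / R)) ^ 3 := one_le_pow₀ h1.le
      calc (1 : ℝ) ≤ (M * (ρ / R)) ^ 3 := h2
        _ = M ^ 3 * (ρ / R) ^ 3 := by ring
    calc law D.carrier δ (a δ) (b δ)
          {γ | (⟨γ.walk.toCurve (meshPoint δ)⟩ : Curve ℂ).HasTraversals (k x ρ R) x ρ R}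
        ≤ 1 := law_le_one _ _ _ _ _
      _ ≤ ENNReal.ofReal (M ^ 3 * (ρ / R) ^ 3) := ENNReal.one_le_ofReal.2 hbig

/-! ## Composition (sorry-free) -/

/-- **The crux from the seven stub STATEMENTS** (kernel-checked composition; every hypothesis is a registered stub's
statement, the conclusion is the route decl `SAWLeftRightFKG.FKGToTraversalBound` BY NAME).  PA feeds the seed (3) and
the assembly (4); the bubble (1) feeds the gate lemma (2), the seed and the assembly; the assembled `SAWCollarBound` is
consumed twice — by the lattice KS iteration at presentable meshes (5) and by the slit necklace at the others (6, with
the germ excursion mean 7); moduli are combined by `max`, mesh classes by `shellTight_of_on`, and the quantile reduction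
gives (H1) for every endpoint approximation. -/
theorem FKGToTraversalBound_of_stubs
    (h₁ : CriticalBubbleBound)
    (h₂ : CriticalBubbleBound → ∀ w₀ : ℕ, GatedPocketBound w₀)
    (h₃ : CriticalBubbleBound → LeftRightFKG → ∃ w₀ : ℕ, WideCollarBound w₀)
    (h₄ : CriticalBubbleBound → (∀ w₀ : ℕ, GatedPocketBound w₀) → (∃ w₀ : ℕ, WideCollarBound w₀) →
      LeftRightFKG → SAWCollarBound)
    (h₅ : SAWCollarBound → GoodShellTight)
    (h₆ : SAWCollarBound → GermExcursionMean → DeepShellTight)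
    (h₇ : GermExcursionMean) : FKGToTraversalBound := by
  intro hPA
  have hEngine : SAWCollarBound := h₄ h₁ (h₂ h₁) (h₃ h₁ hPA) hPA
  obtain ⟨M₁, hM₁, hgood⟩ := h₅ hEngine
  obtain ⟨M₂, -, hdeep⟩ := h₆ hEngine h₇
  refine traversalBound_of_shellTight (M := max M₁ M₂) (lt_max_of_lt_left hM₁) fun D a b hab => ?_
  exact shellTight_of_on (shellTightOn_mono (le_max_left _ _) (hgood D a b hab))
    (shellTightOn_mono (le_max_right _ _) (hdeep D a b hab))

/-- **`FKGToTraversalBound` from the stubs** (the form the skeleton audit reads: concludes the crux by name; `sorry`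
reaches it only through `stub_*`). -/
theorem FKGToTraversalBound_of : FKGToTraversalBound :=
  FKGToTraversalBound_of_stubs stub_criticalBubble stub_gateExcision stub_wideDoorSeed stub_collarAssembly
    stub_shellIteration stub_necklace stub_germExcursionMean

end Summit.CriticalPhenomena.SAWScalingLimit.Cruxes.FKGToTraversalBound.GatesByBubbleDoorsByFKG

end
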